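import Literature.MathematicalPhysics.QuantumFieldTheory.Balaban1983to89.B9Eq3115KnitLetterYFarFace
import Literature.MathematicalPhysics.QuantumFieldTheory.Balaban1983to89.B9B8KnitColumnGauge
import Literature.MathematicalPhysics.QuantumFieldTheory.Balaban1983to89.B7Eq125RightInverse

/-!
# `Balaban1983to89.B9Eq3115KnitLetterYOnto` — T. Bałaban, *Propagators for lattice gauge theories in a background field*, Commun. Math. Phys. **99** (1985) 389–434
# [Balaban1985BackgroundPropagators] (3.12)–(3.15) p. 393, (3.35) p. 396, p. 420; T. Bałaban, *Averaging operations for lattice gauge theories*, Commun. Math. Phys. **98**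
# (1985) 17–51 [Balaban1985Averaging] (139)–(147) pp. 39–40, Prop. 2 p. 26: ★★★ **PRINT's AVERAGING `Q(U) = QknitY` IS ONTO ON THE MEMBER's CLASS (3.35)** — the (L6) law
# «`Q(U)` onto» of def-Y's `QLawsY` (`Node00.OpsYQLetter.IsOntoOnQ`) for the print-faithful letter, keyed to the LOCAL class `Reg335 c₀ α₀ U` and x-free numerics

WHY (cell `pub-ymgap`, node N06, programme P-Q15 ∕ director-ym №375 (5)(L6)).  p. 420 inverts `Q G Q*` («ω = (QGQ*)⁻¹B»), which needs `Q(U)` onto.  For def-Y's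
typed letter `QY parB` this is r03's far-face right inverse (`Node00.OpsYQOnto.QY_surjective`), exact at every `U`.  For print's letter `Q(U)` — [5]'s composite
covariant averaging `Q_j(U) = Q(Ū^{j−1})⋯Q(U)` (my `QknitY`) — the far-face rows are no longer an exact right inverse at a curved background.  File
`B9Eq3115KnitLetterYFarFace` reduced surjectivity to the injectivity of the DIAGONAL maps `Y ↦ (Q(U)(A_ι ⊗ R(T_ι)⁻¹Y))(ι)` (exact level-triangularity); this file
estimates the diagonal: with `T_ι(b) := Û_ι(Γ^{tree}_{x₀,b₋})` the corner-tree holonomies of the RETRACTION `Û_ι` of `U♯` to the double block of `ι`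
(`B9Eq3124HZKnitPairReg335Y` §4), the diagonal map is `Y + O(K(d,L)·α₀′)·‖Y‖` — [5]'s COLUMN THEOREM (t2s-1's `B9B8KnitColumnGauge`) summed over the `L^{jd}`
far-face bonds of height `Lʲ` (an ℓ¹ form of t2s-1's row theorem, §1), the flat part being EXACTLY `Y` by the bond-averaging dictionary and r03's `Q_j ∘ liftIter j = id`
(`Node00.Node00.qK_liftRow_diag`).  Hence injective for `K·α₀′ < 1`, hence ★★★ `QknitY_surjective_of_reg335P`.

WHAT THIS FILE CHECKS (kernel; `ℤ^{d+1}` analysis over landed estimates + torus bookkeeping).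
* §1 (generic `ℤ^D`, C⋆-algebra coefficients) the column constant `kCol D L` of t2s-1 and ★ `norm_linCovIter_sub_sum_linQIter_rot_le_sum` — THE ℓ¹ ROW THEOREM:
  `‖LⁿQ_n(U₀)B(w,κ) − Σ_{b ⊂ box} LⁿQ_n(1)((R(U₀(Γ^{tree}_{x₀,b₋}))B(b))·δ_b)(w,κ)‖ ≤ K(D,L)·α·Lⁿ·L^{−nD}·Σ_{b ⊂ box}‖B(b)‖` (t2s-1's row theorem with the ℓ¹ mass in
  place of `#bonds × sup`); `reg17_univ_of_pdev` ([B8] (1.7) on `ℤ^D` from [5]'s global (52)).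
* §2 torus bookkeeping: box coordinates `crd`, `eq_blk_add_crd`; the sup bound `liftIter_le_pow` (`0 ≤ liftIter k δ_c ≤ Lᵏ`); the retraction `retrY i U ι` of an index bond,
  the in-box lift `xOf i ι p` of a fine site over the source block and the corner-tree transports `farT i U ι b`; ★ `face_of_support` (a box bond carrying the far-face
  row of `ι` is a `κ`-bond from the LAST `κ`-layer of `B^j(ι₋)`), `xOf_transl_eq` (the lift of such a bond's source IS the box point), ★ `card_support_le` (at most `(Lʲ)^d`
  such bonds — injection into `Fin d → Fin Lʲ` by deleting the `κ`-coordinate).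
* §3 ★★ `QknitY_apply_retract` — `(Q(U)a)(ι) = L^{−j}·(LʲQ_j(Û_ι)a♯)(z_ι, κ)` on (3.35) (locality of the gated composite + [5] Prop. 2 for `Û_ι`, ungating);
  ★★ `flat_sum_farRowY_eq` — the flat columns of the transported far-face row re-sum to `Lʲ·Y` EXACTLY (transports cancel, `linQIter_finset_sum`, flat locality, the
  dictionary `linQIter_liftBd_eq_sum_qK`, `qK_liftRow_diag`); ★★ `norm_QknitY_farRowY_sub_le` — `‖(Q(U)(A_ι ⊗ R(T_ι)⁻¹Y))(ι) − Y‖ ≤ K(d+1,L)·α₀′·‖Y‖` on (3.35).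
* §4 ★★★ `QknitY_farRowY_injective_of_reg335P` and ★★★ `QknitY_surjective_of_reg335P (hG1) (hGU) {U} {c₀ α₀} (hc) (hMα) (hreg : (bg9KP (M_N ℂ) G i).Reg335 c₀ α₀ U) {α₀′}
  (hα′) (hαQ : α₀′ ≤ α_Q(d+1,L)) (hK : K_pl(Mα₀)·L⁴ < α₀′) (hsmall : K(d+1,L)·α₀′ < 1) : Function.Surjective (QknitY i U)` — def-Y's (L6) `IsOntoOnQ (regQY G i c₀ α₀) (QknitY i)`
  unfolded, under x-free numerics only.

HONEST SCOPE.  Estimates of [5] ∕ [B9] composed from LANDED theorems (t2s-1's column theorem, [5] Prop. 2, g34's (3.35) coverage); nothing new is asserted about print;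
NOT a discharge of node N06, NOT summit progress; count-neutral; nothing about the continuum limit, reflection positivity or the mass gap.  Cell `pub-ymgap` (HUMAN RULING
D-0062), seat `pub-ymgap-dag-n06-l` (gen 35), 2026-08-30.
-/

noncomputable section

namespace Literature.MathematicalPhysics.QuantumFieldTheory.Balaban1983to89.B9Eq3115KnitLetterYOnto

open scoped BigOperators
open B7Prop1Explicit renaming Site → LSite
open B7Prop1Explicit (e e_apply boxVec hol treeWord plaqWord U1)
open B7Prop1Local (InBox AgreeOn loK bondHiK add_e_apply clampCfg)
open B7Prop5Flat (BondIn bondsIn mem_bondsIn bump bump_eq_zero_of linQIter_congr restr agreeOn_insCfg_restr)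
open B7Prop3Flat (insCfg)
open B7Prop2Explicit (pdev avgClosed_unitaryUnits unitaryUnits unitaryUnits_le_U1 le_pdev pdev_nonneg hol_mem_of C0 c2')
open B7Prop4Flat (linQIter)
open B7Prop4GeneralLevels (linCovIter)
open B7Prop5GeneralLevels (hadd_levels hsmul_levels)
open B7Prop5LineDerivFiniteFamily (linCovIter_family)
open B7Eq78Linearization (conjR conjR_apply conjR_smul)
open B7Prop4LinCovIterClosed (linCovIterC linCovIterC_eq_linCovIter_of_prop2)
open B7Prop4LinCovIterClosedLaws (linCovIterC_congr)
open B7Eq52RetractionExtension (retrCfg retrCfg_eq_of_bondIn retrCfg_mem)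
open B8Ineq132 (plaqF)
open B9Eq316AveragingTransposeZd (alphaQ alphaQ_pos Reg17 four_mul_alphaQ_le)
open B9B8KnitColumnFlatness (linQIter_finset_sum linCovIter_zero_field windows_of_alphaQ)
open B9B8KnitColumnGauge (linCovIter_congr' clamp_regular norm_conjR_le_of_unitary norm_linCovIter_bump_sub_linQIter_rot_le)
open B10Eq27TorusAxialLog (transl transl_apply transl_add_e)
open B4Reflection242 (blk)
open B5Eq118OneStroke (iterBlockOf)
open B5AveragingOnto (bondLift)
open B6GlobalChartV1 (PV)
open B6KLevelCensusIndexV1 (KIdx kGeo)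
open B6SectAOntoV1 (liftIter liftIter_succ liftIter_zero)
open B9B8CarrierDictionary (liftCfg liftCfg_mem)
open B9B8KnitBondTransfer (liftBd liftBd_apply)
open B9B8KnitBondAvgDictionary (linQIter_liftBd_eq_sum_qK val_transl_boxVec)
open B9Eq3115KnitLetterY (zSrc transl_zero_zSrc QknitY QknitY_apply lvl_le')
open B9Eq3124HZKnitPairReg335Y (pdev_retract_bond_lt)
open B9Eq3115KnitLetterYFarFace (farRow farRow_support farRowY farRowY_apply QknitY_surjective_of_diag blk_decomp_boxVec iterBlockOf_transl_zero
  blk_of_inBox_bond shift_ne_self)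
open B9C2FormBoxRegimeY (Kpl)
open B9BackgroundsKLevelV1P (bg9KP mem_of_reg335P)
open Node00

/-! ## §1 The ℓ¹ row theorem on `ℤ^D` -/

section Row

variable {D : ℕ} {𝔸 : Type} [CStarAlgebra 𝔸]

/-- **t2s-1's column constant** `K(D,L) = 4D·L^D·(3200(D+1)²(D+4)L³ + 128D²(D+1)L³L^{−(D+1)} + 8D(D+1)²L³L^{−(D+1)})` of the column theorem
(`B9B8KnitColumnGauge.norm_linCovIter_bump_sub_linQIter_rot_le`), given a name. [cite: Balaban1985Averaging, (139)–(147) pp.39–40] -/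
def kCol (D L : ℕ) : ℝ :=
  4 * D * (L : ℝ) ^ D *
    ((3200 * ((D : ℝ) + 1) ^ 2 * ((D : ℝ) + 4) * (L : ℝ) ^ 3 + 128 * (D : ℝ) ^ 2 * ((D : ℝ) + 1) * ((L : ℝ) ^ 3 * ((L : ℝ) ^ (D + 1))⁻¹)) +
      8 * D * ((D : ℝ) + 1) * ((L : ℝ) ^ 3 * ((L : ℝ) ^ (D + 1))⁻¹) * ((D : ℝ) + 1))

/-- `K(D,L) ≥ 0`. [cite: Balaban1985Averaging, (147) p.40, bookkeeping] -/
theorem kCol_nonneg (D L : ℕ) : 0 ≤ kCol D L := by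
  unfold kCol; positivity

/-- the sum of the single-bond bumps of a field over a finite bond set, evaluated at a member bond. [cite: Balaban1985Averaging, p.24 (after (43)), bookkeeping] -/
theorem sum_bump_apply_of_mem {S : Finset (LSite D × Fin D)} (F : LSite D → Fin D → 𝔸) {x : LSite D} {κ : Fin D}
    (h : (x, κ) ∈ S) : (∑ s ∈ S, bump s.1 s.2 (F s.1 s.2)) x κ = F x κ := by
  classical
  rw [Finset.sum_apply, Finset.sum_apply, Finset.sum_eq_single (x, κ)]
  · simp [bump]
  · rintro ⟨x', κ'⟩ _ hne
    rw [bump_eq_zero_of]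
    rintro ⟨rfl, rfl⟩
    exact hne rfl
  · intro hn; exact absurd h hn

/-- … and at a non-member bond it vanishes. [cite: Balaban1985Averaging, p.24 (after (43)), bookkeeping] -/
theorem sum_bump_apply_of_not_mem {S : Finset (LSite D × Fin D)} (F : LSite D → Fin D → 𝔸) {x : LSite D} {κ : Fin D}
    (h : (x, κ) ∉ S) : (∑ s ∈ S, bump s.1 s.2 (F s.1 s.2)) x κ = 0 := by
  classical
  rw [Finset.sum_apply, Finset.sum_apply]
  refine Finset.sum_eq_zero fun s hs => ?_
  rw [bump_eq_zero_of]
  rintro ⟨rfl, rfl⟩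
  exact h hs

/-- the restriction of a bond field to a finite bond set is the finite sum of its single-bond bumps (t2s-1's private identity, re-proved).
[cite: Balaban1985Averaging, p.24 (after (43)), bookkeeping] -/
theorem insCfg_restr_eq_sum (S : Finset (LSite D × Fin D)) (B : LSite D → Fin D → 𝔸) :
    insCfg S (restr S B) = (0 : LSite D → Fin D → 𝔸) + ∑ s ∈ S, (1 : ℂ) • bump s.1 s.2 (B s.1 s.2) := by
  classical
  funext x κ
  rw [zero_add]
  simp only [one_smul]
  by_cases h : (x, κ) ∈ S
  · rw [sum_bump_apply_of_mem B h]
    simp [insCfg, restr, h]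
  · rw [sum_bump_apply_of_not_mem B h]
    simp [insCfg, h]

/-- **[B8] (1.7) on `ℤ^D` up to level `n` FROM [5]'s GLOBAL (52) at scale `n`**: `pdev U₀ < α·L^{−2n}` ⟹ `Reg17 L n ℤ^D α U₀` (`L ≥ 1`).
[cite: Balaban1985RegularSpaces, (1.7) p.77; Balaban1985Averaging, (52) p.26] -/
theorem reg17_univ_of_pdev [Nontrivial 𝔸] {L : ℕ} (hL : 1 ≤ L) {n : ℕ} {α : ℝ} (hα : 0 ≤ α) {U₀ : LSite D → Fin D → 𝔸ˣ}
    (hU₀ : ∀ x κ, U₀ x κ ∈ unitaryUnits 𝔸) (h : pdev U₀ < α * (((L : ℝ) ^ n)⁻¹) ^ 2) :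
    Reg17 L n (fun _ => (Set.univ : Set (LSite D))) α U₀ := by
  intro j hj x μ ν _ _
  have hU1 : ∀ x κ, U₀ x κ ∈ U1 𝔸 := fun x κ => unitaryUnits_le_U1 (hU₀ x κ)
  have hL1 : (1 : ℝ) ≤ L := by exact_mod_cast hL
  have hmono : (((L : ℝ) ^ n)⁻¹) ^ 2 ≤ (((L : ℝ) ^ j)⁻¹) ^ 2 := by
    have h1 : ((L : ℝ) ^ j) ≤ (L : ℝ) ^ n := pow_le_pow_right₀ hL1 hj
    have h2 : (0 : ℝ) < (L : ℝ) ^ j := by positivity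
    have h3 : ((L : ℝ) ^ n)⁻¹ ≤ ((L : ℝ) ^ j)⁻¹ := inv_anti₀ h2 h1
    exact pow_le_pow_left₀ (by positivity) h3 2
  calc ‖plaqF U₀ μ ν x - 1‖ = ‖((hol U₀ x (plaqWord μ ν) : 𝔸ˣ) : 𝔸) - 1‖ := rfl
    _ ≤ pdev U₀ := le_pdev hU1 x μ ν
    _ < α * (((L : ℝ) ^ n)⁻¹) ^ 2 := h
    _ ≤ α * (((L : ℝ) ^ j)⁻¹) ^ 2 := mul_le_mul_of_nonneg_left hmono hα

variable [Nontrivial 𝔸] {L : ℕ} (hL : 2 ≤ L) (hD : 1 ≤ D) {n : ℕ} {α : ℝ} (hα : 0 < α) (hαQ : α ≤ alphaQ D L)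
  {U₀ : LSite D → Fin D → 𝔸ˣ} (hU₀ : ∀ x κ, U₀ x κ ∈ unitaryUnits 𝔸) (hreg : Reg17 L n (fun _ => (Set.univ : Set (LSite D))) α U₀)

include hL hD hα hαQ hU₀ hreg in
/-- ★ **THE ℓ¹ ROW THEOREM — THE COMPOSITE AVERAGING OF A FIELD AT A CURVED BACKGROUND IS THE FLAT AVERAGE OF THE CORNER-TRANSPORTED FIELD, UP TO
`K(D,L)·α·Lⁿ·L^{−nD}·Σ_{b ⊂ box}‖B(b)‖`.**  For `L ≥ 2`, `D ≥ 1`, `0 < α ≤ α_Q(D,L)`, a unitary `U₀` in (1.7) up to level `n` on `ℤ^D`, a level-`n` bond `(w, κ)` with box corner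
`x₀ = Lⁿw` and any bond field `B`:
`‖LⁿQ_n(U₀)B(w,κ) − Σ_{b ⊂ box} LⁿQ_n(1)((R(U₀(Γ^{tree}_{x₀,b₋}))B(b))·δ_b)(w,κ)‖ ≤ K(D,L)·α·Lⁿ·L^{−nD}·Σ_{b ⊂ box}‖B(b)‖` — t2s-1's row theorem with the ℓ¹ mass of `B` on the
box in place of `#bonds × sup|B|` (same proof: clamp, additivity of the composite at the clamped background, the column theorem bond by bond).
[cite: Balaban1985Averaging, (139)–(147) pp.39–40, (122) p.36, p.24; Balaban1985BackgroundPropagators, (3.28), (3.32) p.395] -/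
theorem norm_linCovIter_sub_sum_linQIter_rot_le_sum (w : LSite D) (κ : Fin D) (B : LSite D → Fin D → 𝔸) :
    ‖linCovIter L U₀ B n w κ -
        ∑ s ∈ bondsIn (loK L n w) (bondHiK L n w κ),
          linQIter L (bump s.1 s.2 (conjR (hol U₀ (loK L n w) (treeWord (s.1 - loK L n w))) (B s.1 s.2))) n w κ‖ ≤
      kCol D L * α * ((L : ℝ) ^ n * (((L : ℝ) ^ n) ^ D)⁻¹) * ∑ s ∈ bondsIn (loK L n w) (bondHiK L n w κ), ‖B s.1 s.2‖ := by
  classical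
  have hL1 : 1 ≤ L := le_trans (by norm_num) hL
  set lo := loK L n w with hlo
  set hi := bondHiK L n w κ with hhi
  set S := bondsIn lo hi with hS
  set lam : ℝ := (L : ℝ) ^ n * (((L : ℝ) ^ n) ^ D)⁻¹ with hlam
  -- clamp and decompose the restriction into bumps
  obtain ⟨hU₁, hpd₁, hag₁⟩ := clamp_regular L hL1 hα hU₀ hreg w κ
  set U₁ := clampCfg lo hi U₀ with hU₁def
  obtain ⟨hα3, -, -⟩ := windows_of_alphaQ (D := D) hL hD hα hαQ
  have hα4 : 4 * α ≤ c2' D L := by have := four_mul_alphaQ_le D L; linarith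
  have hG := avgClosed_unitaryUnits (𝔸 := 𝔸) D L
  have hadd := hadd_levels L hL hG n U₁ hU₁ hα hα3 hα4 hpd₁
  have hsmul := hsmul_levels L hL hG n U₁ hU₁ hα hα3 hα4 hpd₁
  have e1 : linCovIter L U₀ B n w κ = ∑ s ∈ S, linCovIter L U₀ (bump s.1 s.2 (B s.1 s.2)) n w κ := by
    have hloc : linCovIter L U₀ B n w κ = linCovIter L U₁ (insCfg S (restr S B)) n w κ :=
      linCovIter_congr' L hL1 n w κ hag₁.symm (agreeOn_insCfg_restr _ _ B)
    rw [hloc, insCfg_restr_eq_sum S B,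
      linCovIter_family L U₁ n hadd hsmul S (fun _ => (1 : ℂ)) (fun s => bump s.1 s.2 (B s.1 s.2)) 0 n le_rfl w κ,
      linCovIter_zero_field, Pi.zero_apply, Pi.zero_apply, zero_add]
    refine Finset.sum_congr rfl fun s _ => ?_
    rw [one_smul]
    exact linCovIter_congr' L hL1 n w κ hag₁ (fun _ _ _ _ => rfl)
  rw [e1, ← Finset.sum_sub_distrib, Finset.mul_sum]
  -- column theorem bond by bond
  have hcol : ∀ s ∈ S, ‖linCovIter L U₀ (bump s.1 s.2 (B s.1 s.2)) n w κ -
      linQIter L (bump s.1 s.2 (conjR (hol U₀ lo (treeWord (s.1 - lo))) (B s.1 s.2))) n w κ‖ ≤ kCol D L * α * lam * ‖B s.1 s.2‖ := by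
    intro s _
    have h := norm_linCovIter_bump_sub_linQIter_rot_le hL hD hα hαQ hU₀ hreg w κ s.1 s.2 (B s.1 s.2)
    rw [kCol, hlam]
    exact h
  exact (norm_sum_le _ _).trans (Finset.sum_le_sum hcol)

end Row

variable {d ℓ : ℕ} {hd : 1 ≤ d + 1} {hL : Odd (ℓ + 1) ∧ 1 < ℓ + 1} {b₀ b₁ : ℝ}

/-! ## §2 Torus bookkeeping: box coordinates, the height of the far-face rows, the retraction and its corner-tree transports, the face count -/

section Torus

variable (i : KIdx d ℓ hd hL b₀ b₁)

omit i in
/-- the box coordinates of an integer point modulo `Lʲ`. [cite: Balaban1984PropagatorsI, (1.6) p.18, bookkeeping] -/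
def crd (j : ℕ) (x : LSite (d + 1)) : Fin (d + 1) → Fin ((ℓ + 1) ^ j) := fun μ =>
  ⟨(x μ % (((ℓ + 1) ^ j : ℕ) : ℤ)).toNat, by
    have hbz : (0 : ℤ) < (((ℓ + 1) ^ j : ℕ) : ℤ) := by positivity
    have h1 := Int.emod_nonneg (x μ) hbz.ne'
    have h2 := Int.emod_lt_of_pos (x μ) hbz
    omega⟩

omit i in
/-- `x = Lʲ·⌊x/Lʲ⌋ + crd x`. [cite: Balaban1984PropagatorsI, (1.6) p.18, bookkeeping] -/
theorem eq_blk_add_crd (j : ℕ) (x : LSite (d + 1)) :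
    x = (((ℓ + 1) ^ j : ℕ) : ℤ) • blk ((ℓ + 1) ^ j) x + boxVec ((ℓ + 1) ^ j) (crd (d := d) (ℓ := ℓ) j x) := by
  have hbz : (0 : ℤ) < (((ℓ + 1) ^ j : ℕ) : ℤ) := by positivity
  funext μ
  have h1 := Int.emod_nonneg (x μ) hbz.ne'
  simp only [Pi.add_apply, Pi.smul_apply, smul_eq_mul, boxVec, blk, crd]
  rw [Int.toNat_of_nonneg h1]
  linarith [Int.mul_ediv_add_emod (x μ) (((ℓ + 1) ^ j : ℕ) : ℤ)]

omit i in
/-- uniqueness of box coordinates: `x = Lʲz + r` forces `r = crd x`. [cite: Balaban1984PropagatorsI, (1.6) p.18, bookkeeping] -/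
theorem crd_eq_of_eq (j : ℕ) {x z : LSite (d + 1)} {r : Fin (d + 1) → Fin ((ℓ + 1) ^ j)}
    (h : x = (((ℓ + 1) ^ j : ℕ) : ℤ) • z + boxVec ((ℓ + 1) ^ j) r) : blk ((ℓ + 1) ^ j) x = z ∧ crd (d := d) (ℓ := ℓ) j x = r := by
  have hbz : (0 : ℤ) < (((ℓ + 1) ^ j : ℕ) : ℤ) := by positivity
  have hblk : blk ((ℓ + 1) ^ j) x = z := by
    funext μ
    have hμ := congrFun h μ
    simp only [Pi.add_apply, Pi.smul_apply, smul_eq_mul, boxVec] at hμ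
    simp only [blk]
    rw [hμ]
    have hr0 : (0 : ℤ) ≤ ((r μ : ℕ) : ℤ) := by positivity
    have hr1 : ((r μ : ℕ) : ℤ) < (((ℓ + 1) ^ j : ℕ) : ℤ) := by exact_mod_cast (r μ).2
    rw [add_comm, Int.add_mul_ediv_left _ _ hbz.ne', Int.ediv_eq_zero_of_lt hr0 hr1, zero_add]
  refine ⟨hblk, ?_⟩
  have h2 := eq_blk_add_crd (d := d) (ℓ := ℓ) j x
  rw [hblk] at h2
  have h3 : boxVec ((ℓ + 1) ^ j) (crd (d := d) (ℓ := ℓ) j x) = boxVec ((ℓ + 1) ^ j) r := by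
    have := congrArg (fun y => y - (((ℓ + 1) ^ j : ℕ) : ℤ) • z) (h2.symm.trans h)
    simpa using this
  funext μ
  have hμ := congrFun h3 μ
  simp only [boxVec] at hμ
  exact Fin.ext (by exact_mod_cast hμ)

omit i in
/-- **THE HEIGHT OF THE FAR-FACE ROWS**: `liftIter k B ≤ Lᵏ·M` whenever `0 ≤ M` bounds `B` (each lift step multiplies by `L` on the far face and is `0` elsewhere).
[cite: Balaban1984PropagatorsI, (1.11) p.19, (1.18) p.20] -/
theorem liftIter_le_pow {P : Params} : ∀ (k : ℕ) {B : VecField P k ℝ} {M : ℝ}, 0 ≤ M → (∀ c, B c ≤ M) → ∀ b, liftIter k B b ≤ (P.L : ℝ) ^ k * M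
  | 0, B, M, _, hB, b => by rw [liftIter_zero, pow_zero, one_mul]; exact hB b
  | k + 1, B, M, hM, hB, b => by
    rw [liftIter_succ]
    have hB' : ∀ c, bondLift B c ≤ (P.L : ℝ) * M := fun c => by
      unfold bondLift
      split_ifs
      · exact mul_le_mul_of_nonneg_left (hB _) (Nat.cast_nonneg _)
      · positivity
    have h := liftIter_le_pow k (by positivity) hB' b
    calc liftIter k (bondLift B) b ≤ (P.L : ℝ) ^ k * ((P.L : ℝ) * M) := h
      _ = (P.L : ℝ) ^ (k + 1) * M := by ring

/-- the far-face row of `ι` takes values in `[0, L^{j(ι)}]`. [cite: Balaban1984PropagatorsI, (1.18) p.20] -/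
theorem farRow_le (ι : IBondY i) (b : FBondY i) : 0 ≤ farRow i ι b ∧ farRow i ι b ≤ (((ℓ + 1 : ℕ) : ℝ)) ^ (ι.1.1 : ℕ) := by
  have h0 : ∀ c, 0 ≤ Pi.single (M := fun _ => ℝ) ι.1.2 (1 : ℝ) c := fun c => by
    by_cases h : c = ι.1.2
    · rw [h, Pi.single_eq_same]; exact zero_le_one
    · rw [Pi.single_eq_of_ne h]
  have h1 : ∀ c, Pi.single (M := fun _ => ℝ) ι.1.2 (1 : ℝ) c ≤ 1 := fun c => by
    by_cases h : c = ι.1.2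
    · rw [h, Pi.single_eq_same]
    · rw [Pi.single_eq_of_ne h]; exact zero_le_one
  refine ⟨Node00.liftIter_nonneg _ h0 b, ?_⟩
  have h := liftIter_le_pow (P := PV d ℓ i.m i.K hd hL) (ι.1.1 : ℕ) zero_le_one h1 b
  rw [mul_one] at h
  exact h

variable {𝔸 : Type} [NormedRing 𝔸] [NormOneClass 𝔸] [NormedAlgebra ℂ 𝔸] [CompleteSpace 𝔸]

/-- **THE RETRACTION `Û_ι`** of the periodic lift `U♯` to the double block `[Lʲz_ι, Lʲz_ι + (Lʲ−1)𝟙 + Lʲe_κ]` of the index bond `ι` (file `B9Eq3124HZKnitPairReg335Y` §4).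
[cite: Balaban1985Averaging, Prop. 2 p.26 (locality sentence), p.24; Balaban1985BackgroundPropagators, (3.35) p.396] -/
def retrY (U : CfgY 𝔸 i) (ι : IBondY i) : LSite (d + 1) → Fin (d + 1) → 𝔸ˣ :=
  retrCfg (loK (ℓ + 1) (ι.1.1 : ℕ) (zSrc i ι)) (bondHiK (ℓ + 1) (ι.1.1 : ℕ) (zSrc i ι) ι.1.2.dir) (liftCfg U)

/-- the IN-BOX INTEGER LIFT of a fine torus site over the source block of `ι`: `Lʲz_ι + (p mod Lʲ)`. [cite: Balaban1984PropagatorsI, (1.6) p.18, (1.18) p.20, dictionary] -/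
def xOf (ι : IBondY i) (p : Site (PV d ℓ i.m i.K hd hL) 0) : LSite (d + 1) :=
  (((ℓ + 1) ^ (ι.1.1 : ℕ) : ℕ) : ℤ) • zSrc i ι + boxVec ((ℓ + 1) ^ (ι.1.1 : ℕ)) fun ν => ⟨(p ν).val % (ℓ + 1) ^ (ι.1.1 : ℕ), Nat.mod_lt _ (by positivity)⟩

/-- **THE CORNER-TREE TRANSPORTS `T_ι(b) = Û_ι(Γ^{tree}_{x₀, b₋})`** from the box corner `x₀ = Lʲz_ι` to the lift of the fine bond's source (t2s-1's column transport).
[cite: Balaban1985Averaging, (11) p.19, pp.24–25, (139)–(147) pp.39–40; Balaban1985BackgroundPropagators, (3.32) p.395] -/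
def farT (U : CfgY 𝔸 i) (ι : IBondY i) (b : FBondY i) : 𝔸ˣ :=
  hol (retrY i U ι) (loK (ℓ + 1) (ι.1.1 : ℕ) (zSrc i ι)) (treeWord (xOf i ι b.src - loK (ℓ + 1) (ι.1.1 : ℕ) (zSrc i ι)))

omit [NormOneClass 𝔸] in
/-- `Û_ι` agrees with `U♯` on the box bonds. [cite: Balaban1985Averaging, p.24 (locality), p.26] -/
theorem agreeOn_liftCfg_retrY (U : CfgY 𝔸 i) (ι : IBondY i) :
    AgreeOn (loK (ℓ + 1) (ι.1.1 : ℕ) (zSrc i ι)) (bondHiK (ℓ + 1) (ι.1.1 : ℕ) (zSrc i ι) ι.1.2.dir) (liftCfg U) (retrY i U ι) :=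
  fun _ _ hx hxe => (retrCfg_eq_of_bondIn (liftCfg U) ⟨hx, hxe⟩).symm

omit [NormOneClass 𝔸] in
/-- `Û_ι` is `G`-valued when `U` is. [cite: Balaban1985Averaging, p.26, bookkeeping] -/
theorem retrY_mem {G : Subgroup 𝔸ˣ} {U : CfgY 𝔸 i} (hU : ∀ μ x, U μ x ∈ G) (ι : IBondY i) (x : LSite (d + 1)) (μ : Fin (d + 1)) :
    retrY i U ι x μ ∈ G :=
  retrCfg_mem (fun x μ => liftCfg_mem hU x μ) x μ

omit [NormOneClass 𝔸] in
/-- the corner-tree transports are `G`-valued when `U` is. [cite: Balaban1985Averaging, p.18 («U(N)»), bookkeeping] -/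
theorem farT_mem {G : Subgroup 𝔸ˣ} {U : CfgY 𝔸 i} (hU : ∀ μ x, U μ x ∈ G) (ι : IBondY i) (b : FBondY i) : farT i U ι b ∈ G :=
  hol_mem_of (retrY_mem i hU ι) _ _

/-- ★ **A BOX BOND CARRYING THE FAR-FACE ROW OF `ι` IS A `κ`-BOND FROM THE LAST `κ`-LAYER OF `B^j(ι₋)` INTO `B^j(ι₊)`**: its direction is `κ`, the `Lʲ`-label of its source
is `z_ι` and that of its target is `z_ι + e_κ`. [cite: Balaban1984PropagatorsI, (1.11) p.19, (1.18) p.20; Balaban1985Averaging, p.24] -/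
theorem face_of_support (ι : IBondY i) {x : LSite (d + 1)} {ν : Fin (d + 1)}
    (hx : BondIn (loK (ℓ + 1) (ι.1.1 : ℕ) (zSrc i ι)) (bondHiK (ℓ + 1) (ι.1.1 : ℕ) (zSrc i ι) ι.1.2.dir) x ν)
    (hb : farRow i ι ⟨transl (0 : Site (PV d ℓ i.m i.K hd hL) 0) x, ν⟩ ≠ 0) :
    ν = ι.1.2.dir ∧ blk ((ℓ + 1) ^ (ι.1.1 : ℕ)) x = zSrc i ι ∧ blk ((ℓ + 1) ^ (ι.1.1 : ℕ)) (x + e ι.1.2.dir) = zSrc i ι + e ι.1.2.dir := by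
  have hj : (ι.1.1 : ℕ) ≤ i.m + i.K := (lvl_le' i ι).trans i.hk
  obtain ⟨hdir, hsrc, htgt⟩ := farRow_support i hb
  simp only at hdir hsrc htgt
  have hne : ι.1.2.tgt ≠ ι.1.2.src :=
    shift_ne_self (Nat.succ_le_of_lt ((PV d ℓ i.m i.K hd hL).one_lt_sitesPerDir (ι.1.1 : ℕ))) ι.1.2.src ι.1.2.dir
  have htgt' : transl (0 : Site (PV d ℓ i.m i.K hd hL) (ι.1.1 : ℕ)) (zSrc i ι + e ι.1.2.dir) = ι.1.2.tgt := by
    rw [transl_add_e, transl_zero_zSrc]; rfl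
  refine ⟨hdir, ?_, ?_⟩
  · rcases blk_of_inBox_bond hx.1 with h | h
    · exact h
    · exfalso
      rw [iterBlockOf_transl_zero i hj, h, htgt'] at hsrc
      exact hne hsrc
  · have hx2 := hx.2
    rw [hdir] at hx2
    rcases blk_of_inBox_bond hx2 with h | h
    · exfalso
      have ht : iterBlockOf (ι.1.1 : ℕ) (transl (0 : Site (PV d ℓ i.m i.K hd hL) 0) (x + e ι.1.2.dir)) = ι.1.2.tgt := by
        rw [transl_add_e, ← hdir]
        exact htgt
      rw [iterBlockOf_transl_zero i hj, h, transl_zero_zSrc] at ht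
      exact hne ht.symm
    · exact h

/-- the `κ`-coordinate of such a bond's source is the LAST one of its block: `crd x κ = Lʲ − 1`. [cite: Balaban1984PropagatorsI, (1.11) p.19, bookkeeping] -/
theorem crd_dir_of_support (ι : IBondY i) {x : LSite (d + 1)} {ν : Fin (d + 1)}
    (hx : BondIn (loK (ℓ + 1) (ι.1.1 : ℕ) (zSrc i ι)) (bondHiK (ℓ + 1) (ι.1.1 : ℕ) (zSrc i ι) ι.1.2.dir) x ν)
    (hb : farRow i ι ⟨transl (0 : Site (PV d ℓ i.m i.K hd hL) 0) x, ν⟩ ≠ 0) :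
    ((crd (d := d) (ℓ := ℓ) (ι.1.1 : ℕ) x ι.1.2.dir : ℕ) : ℤ) = (((ℓ + 1) ^ (ι.1.1 : ℕ) : ℕ) : ℤ) - 1 := by
  obtain ⟨-, h1, h2⟩ := face_of_support i ι hx hb
  have e1 := eq_blk_add_crd (d := d) (ℓ := ℓ) (ι.1.1 : ℕ) x
  have e2 := eq_blk_add_crd (d := d) (ℓ := ℓ) (ι.1.1 : ℕ) (x + e ι.1.2.dir)
  rw [h1] at e1
  rw [h2] at e2
  have c1 := congrFun e1 ι.1.2.dir
  have c2 := congrFun e2 ι.1.2.dir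
  simp only [Pi.add_apply, Pi.smul_apply, smul_eq_mul, boxVec, e_apply, ite_true, mul_add, mul_one] at c1 c2
  have hr1 : ((crd (d := d) (ℓ := ℓ) (ι.1.1 : ℕ) x ι.1.2.dir : ℕ) : ℤ) < (((ℓ + 1) ^ (ι.1.1 : ℕ) : ℕ) : ℤ) := by
    exact_mod_cast (crd (ι.1.1 : ℕ) x ι.1.2.dir).2
  have hr2 : (0 : ℤ) ≤ ((crd (d := d) (ℓ := ℓ) (ι.1.1 : ℕ) (x + e ι.1.2.dir) ι.1.2.dir : ℕ) : ℤ) := by positivity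
  linarith

/-- ★ **THE IN-BOX LIFT OF SUCH A BOND's SOURCE IS THE BOX POINT**: `xOf ι (0 + x) = x`. [cite: Balaban1984PropagatorsI, (1.6) p.18, (1.18) p.20, dictionary] -/
theorem xOf_transl_eq (ι : IBondY i) {x : LSite (d + 1)} {ν : Fin (d + 1)}
    (hx : BondIn (loK (ℓ + 1) (ι.1.1 : ℕ) (zSrc i ι)) (bondHiK (ℓ + 1) (ι.1.1 : ℕ) (zSrc i ι) ι.1.2.dir) x ν)
    (hb : farRow i ι ⟨transl (0 : Site (PV d ℓ i.m i.K hd hL) 0) x, ν⟩ ≠ 0) :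
    xOf i ι (transl (0 : Site (PV d ℓ i.m i.K hd hL) 0) x) = x := by
  have hj : (ι.1.1 : ℕ) ≤ i.m + i.K := (lvl_le' i ι).trans i.hk
  obtain ⟨-, h1, -⟩ := face_of_support i ι hx hb
  have e1 := eq_blk_add_crd (d := d) (ℓ := ℓ) (ι.1.1 : ℕ) x
  rw [h1] at e1
  unfold xOf
  conv_rhs => rw [e1]
  congr 1
  congr 1
  funext μ
  apply Fin.ext
  show (transl (0 : Site (PV d ℓ i.m i.K hd hL) 0) x μ).val % (ℓ + 1) ^ (ι.1.1 : ℕ) = (crd (ι.1.1 : ℕ) x μ : ℕ)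
  conv_lhs => rw [e1]
  rw [val_transl_boxVec hj (zSrc i ι) (crd (d := d) (ℓ := ℓ) (ι.1.1 : ℕ) x) μ, Nat.mul_add_mod, Nat.mod_eq_of_lt (crd (ι.1.1 : ℕ) x μ).2]

omit [NormOneClass 𝔸] in
/-- on the support, the corner-tree transport of the torus bond IS t2s-1's column transport of the box bond. [cite: Balaban1985Averaging, (139)–(147) pp.39–40, dictionary] -/
theorem farT_eq_of_support (U : CfgY 𝔸 i) (ι : IBondY i) {x : LSite (d + 1)} {ν : Fin (d + 1)}
    (hx : BondIn (loK (ℓ + 1) (ι.1.1 : ℕ) (zSrc i ι)) (bondHiK (ℓ + 1) (ι.1.1 : ℕ) (zSrc i ι) ι.1.2.dir) x ν)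
    (hb : farRow i ι ⟨transl (0 : Site (PV d ℓ i.m i.K hd hL) 0) x, ν⟩ ≠ 0) :
    farT i U ι ⟨transl (0 : Site (PV d ℓ i.m i.K hd hL) 0) x, ν⟩
      = hol (retrY i U ι) (loK (ℓ + 1) (ι.1.1 : ℕ) (zSrc i ι)) (treeWord (x - loK (ℓ + 1) (ι.1.1 : ℕ) (zSrc i ι))) := by
  unfold farT
  rw [show (⟨transl (0 : Site (PV d ℓ i.m i.K hd hL) 0) x, ν⟩ : FBondY i).src = transl _ x from rfl, xOf_transl_eq i ι hx hb]

/-- ★ **THE FACE COUNT**: at most `(Lʲ)^d` box bonds of the double block of `ι` carry its far-face row (deleting the `κ`-coordinate of the source is injective into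
`Fin d → Fin Lʲ`). [cite: Balaban1984PropagatorsI, (1.11) p.19, (1.18) p.20; Balaban1985Averaging, (141) p.39 (bond count)] -/
theorem card_support_le (ι : IBondY i) :
    ((bondsIn (loK (ℓ + 1) (ι.1.1 : ℕ) (zSrc i ι)) (bondHiK (ℓ + 1) (ι.1.1 : ℕ) (zSrc i ι) ι.1.2.dir)).filter
        (fun s => farRow i ι ⟨transl (0 : Site (PV d ℓ i.m i.K hd hL) 0) s.1, s.2⟩ ≠ 0)).card
      ≤ ((ℓ + 1) ^ (ι.1.1 : ℕ)) ^ d := by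
  classical
  set N : ℕ := (ℓ + 1) ^ (ι.1.1 : ℕ) with hN
  set κ := ι.1.2.dir with hκ
  set S' := (bondsIn (loK (ℓ + 1) (ι.1.1 : ℕ) (zSrc i ι)) (bondHiK (ℓ + 1) (ι.1.1 : ℕ) (zSrc i ι) ι.1.2.dir)).filter
        (fun s => farRow i ι ⟨transl (0 : Site (PV d ℓ i.m i.K hd hL) 0) s.1, s.2⟩ ≠ 0) with hS'
  let φ : LSite (d + 1) × Fin (d + 1) → (Fin d → Fin N) := fun s t => crd (d := d) (ℓ := ℓ) (ι.1.1 : ℕ) s.1 (κ.succAbove t)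
  have hinj : Set.InjOn φ (S' : Set (LSite (d + 1) × Fin (d + 1))) := by
    intro s hs s' hs' hφ
    rw [Finset.mem_coe, hS', Finset.mem_filter, mem_bondsIn] at hs hs'
    obtain ⟨hd1, hb1, -⟩ := face_of_support i ι hs.1 hs.2
    obtain ⟨hd2, hb2, -⟩ := face_of_support i ι hs'.1 hs'.2
    have hc1 := crd_dir_of_support i ι hs.1 hs.2
    have hc2 := crd_dir_of_support i ι hs'.1 hs'.2
    have hcrd : crd (d := d) (ℓ := ℓ) (ι.1.1 : ℕ) s.1 = crd (d := d) (ℓ := ℓ) (ι.1.1 : ℕ) s'.1 := by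
      funext μ
      by_cases hμ : μ = κ
      · rw [hμ]; exact Fin.ext (by exact_mod_cast hc1.trans hc2.symm)
      · obtain ⟨t, ht⟩ := Fin.exists_succAbove_eq hμ
        have := congrFun hφ t
        simp only [φ] at this
        rw [ht] at this
        exact this
    have e1 := eq_blk_add_crd (d := d) (ℓ := ℓ) (ι.1.1 : ℕ) s.1
    have e2 := eq_blk_add_crd (d := d) (ℓ := ℓ) (ι.1.1 : ℕ) s'.1
    rw [hb1] at e1
    rw [hb2] at e2
    refine Prod.ext ?_ (hd1.trans hd2.symm)
    rw [e1, e2, hcrd]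
  have hmaps : Set.MapsTo φ (S' : Set (LSite (d + 1) × Fin (d + 1))) ((Finset.univ : Finset (Fin d → Fin N)) : Set (Fin d → Fin N)) :=
    fun _ _ => Finset.mem_coe.2 (Finset.mem_univ _)
  have h := Finset.card_le_card_of_injOn φ hmaps hinj
  rw [Finset.card_univ, Fintype.card_fun, Fintype.card_fin, Fintype.card_fin] at h
  exact h

end Torus

/-! ## §3 The diagonal of `Q(U)` on the transported far-face rows, on (3.35) -/

section Diagonal

open scoped Matrix Matrix.Norms.L2Operator

variable {N : ℕ} [Nonempty (Fin N)] (i : KIdx d ℓ hd hL b₀ b₁) {G : Subgroup (Matrix (Fin N) (Fin N) ℂ)ˣ}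

/-- ★★ **`(Q(U)a)(ι)` THROUGH THE RETRACTION, UNGATED, ON (3.35)**: `(Q(U)a)(ι) = L^{−j}·(LʲQ_j(Û_ι)a♯)(z_ι, κ)` — locality of the gated composite (file 3) moves `U♯` to
`Û_ι`; [5] Prop. 2 for `Û_ι` (`pdev Û_ι < α₀′L^{−2j}`, file 5) opens every gate. [cite: Balaban1985BackgroundPropagators, (3.12)–(3.15) p.393, (3.35) p.396; Balaban1985Averaging, Prop. 2 p.26, p.24] -/
theorem QknitY_apply_retract (hG1 : ∀ u : (Matrix (Fin N) (Fin N) ℂ)ˣ, u ∈ G → ‖(u : Matrix (Fin N) (Fin N) ℂ)‖ ≤ 1)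
    (hGU : G ≤ unitaryUnits (Matrix (Fin N) (Fin N) ℂ))
    (U : CfgY (Matrix (Fin N) (Fin N) ℂ) i) {c₀ α₀ : ℝ} (hc : c₀ ≤ 10) (hMα : 0 ≤ (kGeo i).M * α₀)
    (hreg : (bg9KP (Matrix (Fin N) (Fin N) ℂ) G i).Reg335 c₀ α₀ U) {α₀' : ℝ} (hα' : 0 < α₀') (hα3 : C0 (d + 1) * α₀' ≤ 1 / 3)
    (hα2 : 2 * α₀' ≤ c2' (d + 1) (ℓ + 1)) (hK : Kpl i ((kGeo i).M * α₀) * (kGeo i).L ^ 4 < α₀') (a : FBondY i → Matrix (Fin N) (Fin N) ℂ) (ι : IBondY i) :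
    QknitY i U a ι = (((((ℓ + 1 : ℕ) : ℝ) ^ (ι.1.1 : ℕ))⁻¹ : ℝ) : ℂ) • linCovIter (ℓ + 1) (retrY i U ι) (liftBd i a) (ι.1.1 : ℕ) (zSrc i ι) ι.1.2.dir := by
  letI : CStarAlgebra (Matrix (Fin N) (Fin N) ℂ) := {}
  have hL1 : 1 ≤ ℓ + 1 := Nat.succ_pos ℓ
  have hL2 : 2 ≤ ℓ + 1 := hL.2
  have hU : ∀ μ x, U μ x ∈ unitaryUnits (Matrix (Fin N) (Fin N) ℂ) := fun μ x => hGU (mem_of_reg335P (G := G) i hreg μ x)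
  have hVu : ∀ x μ, retrY i U ι x μ ∈ unitaryUnits (Matrix (Fin N) (Fin N) ℂ) := retrY_mem i hU ι
  have h52 : pdev (retrY i U ι) < α₀' * ((((ℓ + 1 : ℕ) : ℝ) ^ (ι.1.1 : ℕ))⁻¹) ^ 2 := pdev_retract_bond_lt i hG1 U hc hMα hreg hK ι
  have hung := linCovIterC_eq_linCovIter_of_prop2 (ℓ + 1) (retrY i U ι) hL2 (avgClosed_unitaryUnits (d + 1) (ℓ + 1)) (ι.1.1 : ℕ) hVu hα' hα3 hα2 h52
    (liftBd i a) (ι.1.1 : ℕ) le_rfl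
  rw [QknitY_apply, linCovIterC_congr (ℓ + 1) hL1 (ι.1.1 : ℕ) (zSrc i ι) ι.1.2.dir (agreeOn_liftCfg_retrY i U ι) (fun _ _ _ _ => rfl), hung]

omit [Nonempty (Fin N)] in
/-- on every box bond, the column transport of the transported far-face row carrying `Y` is the flat row carrying `Y`: `R(T_b)(A_ι(b)·R(T_b)⁻¹Y) = A_ι(b)·Y`.
[cite: Balaban1985Averaging, (139)–(147) pp.39–40; Balaban1984PropagatorsI, (1.18) p.20] -/
theorem conjR_farRowY_of_bondIn (U : CfgY (Matrix (Fin N) (Fin N) ℂ) i) (ι : IBondY i) (Y : Matrix (Fin N) (Fin N) ℂ) {x : LSite (d + 1)} {ν : Fin (d + 1)}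
    (hx : BondIn (loK (ℓ + 1) (ι.1.1 : ℕ) (zSrc i ι)) (bondHiK (ℓ + 1) (ι.1.1 : ℕ) (zSrc i ι) ι.1.2.dir) x ν) :
    conjR (hol (retrY i U ι) (loK (ℓ + 1) (ι.1.1 : ℕ) (zSrc i ι)) (treeWord (x - loK (ℓ + 1) (ι.1.1 : ℕ) (zSrc i ι))))
        (liftBd i (farRowY i (farT i U) ι Y) x ν)
      = ((farRow i ι ⟨transl (0 : Site (PV d ℓ i.m i.K hd hL) 0) x, ν⟩ : ℝ) : ℂ) • Y := by
  rw [liftBd_apply, farRowY_apply]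
  by_cases hb : farRow i ι ⟨transl (0 : Site (PV d ℓ i.m i.K hd hL) 0) x, ν⟩ = 0
  · rw [hb, Complex.ofReal_zero, zero_smul, zero_smul, conjR_apply, mul_zero, zero_mul]
  · rw [conjR_smul, farT_eq_of_support i U ι hx hb, B7Eq125RightInverse.conjR_conjR_inv]

omit [Nonempty (Fin N)] in
/-- ★★ **THE FLAT COLUMNS OF THE TRANSPORTED FAR-FACE ROW RE-SUM TO `Lʲ·Y` EXACTLY**: the transports cancel bond by bond, the single-bond flat averages re-sum
(`linQIter_finset_sum` + flat locality) to the flat average of the far-face row carrying `Y`, which is `Lʲ·(Σ_b qK(ι,b)A_ι(b))·Y = Lʲ·Y` by the bond-averaging dictionary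
and `Q_j ∘ liftIter j = id`. [cite: Balaban1984PropagatorsI, (1.18) p.20; Balaban1985Averaging, (125)–(127) pp.36–37; Balaban1985BackgroundPropagators, (3.12) p.392] -/
theorem flat_sum_farRowY_eq (U : CfgY (Matrix (Fin N) (Fin N) ℂ) i) (ι : IBondY i) (Y : Matrix (Fin N) (Fin N) ℂ) :
    ∑ s ∈ bondsIn (loK (ℓ + 1) (ι.1.1 : ℕ) (zSrc i ι)) (bondHiK (ℓ + 1) (ι.1.1 : ℕ) (zSrc i ι) ι.1.2.dir),
        linQIter (ℓ + 1) (bump s.1 s.2 (conjR (hol (retrY i U ι) (loK (ℓ + 1) (ι.1.1 : ℕ) (zSrc i ι)) (treeWord (s.1 - loK (ℓ + 1) (ι.1.1 : ℕ) (zSrc i ι))))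
          (liftBd i (farRowY i (farT i U) ι Y) s.1 s.2))) (ι.1.1 : ℕ) (zSrc i ι) ι.1.2.dir
      = (((((ℓ + 1 : ℕ) : ℝ)) ^ (ι.1.1 : ℕ) : ℝ) : ℂ) • Y := by
  classical
  letI : CStarAlgebra (Matrix (Fin N) (Fin N) ℂ) := {}
  set lo := loK (ℓ + 1) (ι.1.1 : ℕ) (zSrc i ι) with hlo
  set hi := bondHiK (ℓ + 1) (ι.1.1 : ℕ) (zSrc i ι) ι.1.2.dir with hhi
  set S := bondsIn lo hi with hS
  -- the flat row carrying `Y`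
  set Bf : LSite (d + 1) → Fin (d + 1) → Matrix (Fin N) (Fin N) ℂ :=
    liftBd i (fun b => ((farRow i ι b : ℝ) : ℂ) • Y) with hBf
  have hterm : ∀ s ∈ S, bump s.1 s.2 (conjR (hol (retrY i U ι) lo (treeWord (s.1 - lo))) (liftBd i (farRowY i (farT i U) ι Y) s.1 s.2))
      = bump s.1 s.2 (Bf s.1 s.2) := by
    intro s hs
    rw [conjR_farRowY_of_bondIn i U ι Y (mem_bondsIn.1 hs), hBf, liftBd_apply]
  rw [Finset.sum_congr rfl fun s hs => by rw [hterm s hs], ← Finset.sum_apply, ← Finset.sum_apply,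
    ← linQIter_finset_sum (ℓ + 1) S (fun s => bump s.1 s.2 (Bf s.1 s.2)) (ι.1.1 : ℕ)]
  -- flat locality: the bump sum agrees with `Bf` on the box bonds
  have hag : AgreeOn lo hi (∑ s ∈ S, bump s.1 s.2 (Bf s.1 s.2)) Bf := fun x κ hx hxe =>
    sum_bump_apply_of_mem Bf (mem_bondsIn.2 ⟨hx, hxe⟩)
  rw [linQIter_congr (ℓ + 1) (ι.1.1 : ℕ) (zSrc i ι) ι.1.2.dir hag, hBf, linQIter_liftBd_eq_sum_qK i ι (zSrc i ι) (transl_zero_zSrc i ι)]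
  congr 1
  simp_rw [smul_smul, ← Complex.ofReal_mul]
  rw [← Finset.sum_smul, ← Complex.ofReal_sum]
  have hdiag := Node00.qK_liftRow_diag i ι
  rw [show (∑ b, qK i ι b * farRow i ι b) = 1 from hdiag, Complex.ofReal_one, one_smul]

/-- the ℓ¹ mass of the transported far-face row on the box: `Σ_{b ⊂ box}‖(A_ι ⊗ R(T_ι)⁻¹Y)♯(b)‖ ≤ (Lʲ)^{d}·Lʲ·‖Y‖` for unitary transports (height `Lʲ` on at most `(Lʲ)^d` bonds).
[cite: Balaban1984PropagatorsI, (1.11) p.19, (1.18) p.20; Balaban1985Averaging, (141) p.39] -/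
theorem sum_norm_liftBd_farRowY_le {U : CfgY (Matrix (Fin N) (Fin N) ℂ) i} (hU : ∀ μ x, U μ x ∈ unitaryUnits (Matrix (Fin N) (Fin N) ℂ))
    (ι : IBondY i) (Y : Matrix (Fin N) (Fin N) ℂ) :
    ∑ s ∈ bondsIn (loK (ℓ + 1) (ι.1.1 : ℕ) (zSrc i ι)) (bondHiK (ℓ + 1) (ι.1.1 : ℕ) (zSrc i ι) ι.1.2.dir), ‖liftBd i (farRowY i (farT i U) ι Y) s.1 s.2‖
      ≤ ((((ℓ + 1) ^ (ι.1.1 : ℕ)) ^ d : ℕ) : ℝ) * ((((ℓ + 1 : ℕ) : ℝ)) ^ (ι.1.1 : ℕ) * ‖Y‖) := by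
  classical
  letI : CStarAlgebra (Matrix (Fin N) (Fin N) ℂ) := {}
  set S := bondsIn (loK (ℓ + 1) (ι.1.1 : ℕ) (zSrc i ι)) (bondHiK (ℓ + 1) (ι.1.1 : ℕ) (zSrc i ι) ι.1.2.dir) with hS
  set p : LSite (d + 1) × Fin (d + 1) → Prop := fun s => farRow i ι ⟨transl (0 : Site (PV d ℓ i.m i.K hd hL) 0) s.1, s.2⟩ ≠ 0 with hp
  have hT : ∀ b, (farT i U ι b)⁻¹ ∈ unitaryUnits (Matrix (Fin N) (Fin N) ℂ) := fun b => (unitaryUnits _).inv_mem (farT_mem i hU ι b)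
  -- termwise bound
  have hle : ∀ s ∈ S, ‖liftBd i (farRowY i (farT i U) ι Y) s.1 s.2‖ ≤ if p s then (((ℓ + 1 : ℕ) : ℝ)) ^ (ι.1.1 : ℕ) * ‖Y‖ else 0 := by
    intro s _
    rw [liftBd_apply, farRowY_apply]
    split_ifs with h
    · rw [norm_smul, Complex.norm_real, Real.norm_of_nonneg (farRow_le i ι _).1]
      exact mul_le_mul (farRow_le i ι _).2 (norm_conjR_le_of_unitary (hT _) Y) (norm_nonneg _) (by positivity)
    · have h' : farRow i ι ⟨transl (0 : Site (PV d ℓ i.m i.K hd hL) 0) s.1, s.2⟩ = 0 := by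
        rw [hp] at h; exact not_ne_iff.1 h
      rw [h', Complex.ofReal_zero, zero_smul, norm_zero]
  refine (Finset.sum_le_sum hle).trans ?_
  rw [Finset.sum_ite, Finset.sum_const_zero, add_zero, Finset.sum_const, nsmul_eq_mul]
  refine mul_le_mul_of_nonneg_right ?_ (by positivity)
  exact_mod_cast card_support_le i ι

/-- ★★ **THE DIAGONAL OF `Q(U)` ON THE TRANSPORTED FAR-FACE ROWS IS `1 + O(K·α₀′)` ON (3.35)**: `‖(Q(U)(A_ι ⊗ R(T_ι)⁻¹Y))(ι) − Y‖ ≤ K(d+1,L)·α₀′·‖Y‖` for every member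
background of the class `(bg9KP …).Reg335 c₀ α₀`, `G ≤ U(N)` unit-bounded, `c₀ ≤ 10`, `0 ≤ Mα₀`, and x-free numerics `0 < α₀′ ≤ α_Q(d+1,L)`, `K_pl(Mα₀)·L⁴ < α₀′`
(§3's retraction formula + §1's ℓ¹ row theorem at `Û_ι` + the exact flat re-summation + the mass bound).
[cite: Balaban1985Averaging, (139)–(147) pp.39–40, Prop. 2 p.26; Balaban1985BackgroundPropagators, (3.12)–(3.15) p.393, (3.35) p.396; Balaban1984PropagatorsI, (1.18) p.20] -/
theorem norm_QknitY_farRowY_sub_le (hG1 : ∀ u : (Matrix (Fin N) (Fin N) ℂ)ˣ, u ∈ G → ‖(u : Matrix (Fin N) (Fin N) ℂ)‖ ≤ 1)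
    (hGU : G ≤ unitaryUnits (Matrix (Fin N) (Fin N) ℂ))
    {U : CfgY (Matrix (Fin N) (Fin N) ℂ) i} {c₀ α₀ : ℝ} (hc : c₀ ≤ 10) (hMα : 0 ≤ (kGeo i).M * α₀)
    (hreg : (bg9KP (Matrix (Fin N) (Fin N) ℂ) G i).Reg335 c₀ α₀ U) {α₀' : ℝ} (hα' : 0 < α₀') (hαQ : α₀' ≤ alphaQ (d + 1) (ℓ + 1))
    (hK : Kpl i ((kGeo i).M * α₀) * (kGeo i).L ^ 4 < α₀') (ι : IBondY i) (Y : Matrix (Fin N) (Fin N) ℂ) :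
    ‖QknitY i U (farRowY i (farT i U) ι Y) ι - Y‖ ≤ kCol (d + 1) (ℓ + 1) * α₀' * ‖Y‖ := by
  classical
  letI : CStarAlgebra (Matrix (Fin N) (Fin N) ℂ) := {}
  have hL1 : 1 ≤ ℓ + 1 := Nat.succ_pos ℓ
  have hL2 : 2 ≤ ℓ + 1 := hL.2
  have hD : 1 ≤ d + 1 := Nat.succ_pos d
  obtain ⟨hα3, hα2, -⟩ := windows_of_alphaQ (D := d + 1) hL2 hD hα' hαQ
  have hU : ∀ μ x, U μ x ∈ unitaryUnits (Matrix (Fin N) (Fin N) ℂ) := fun μ x => hGU (mem_of_reg335P (G := G) i hreg μ x)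
  have hVu : ∀ x μ, retrY i U ι x μ ∈ unitaryUnits (Matrix (Fin N) (Fin N) ℂ) := retrY_mem i hU ι
  have h52 : pdev (retrY i U ι) < α₀' * ((((ℓ + 1 : ℕ) : ℝ) ^ (ι.1.1 : ℕ))⁻¹) ^ 2 := pdev_retract_bond_lt i hG1 U hc hMα hreg hK ι
  have hreg17 : Reg17 (ℓ + 1) (ι.1.1 : ℕ) (fun _ => (Set.univ : Set (LSite (d + 1)))) α₀' (retrY i U ι) :=
    reg17_univ_of_pdev hL1 hα'.le hVu (by exact_mod_cast h52)
  set Nn : ℕ := (ℓ + 1) ^ (ι.1.1 : ℕ) with hNn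
  set Lj : ℝ := (((ℓ + 1 : ℕ) : ℝ)) ^ (ι.1.1 : ℕ) with hLj
  have hLj0 : 0 < Lj := by positivity
  have hLjN : ((Nn : ℕ) : ℝ) = Lj := by rw [hNn, hLj]; push_cast; ring
  set B := liftBd i (farRowY i (farT i U) ι Y) with hB
  set S := bondsIn (loK (ℓ + 1) (ι.1.1 : ℕ) (zSrc i ι)) (bondHiK (ℓ + 1) (ι.1.1 : ℕ) (zSrc i ι) ι.1.2.dir) with hS
  set main := linCovIter (ℓ + 1) (retrY i U ι) B (ι.1.1 : ℕ) (zSrc i ι) ι.1.2.dir with hmain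
  set flat := ∑ s ∈ S, linQIter (ℓ + 1) (bump s.1 s.2 (conjR (hol (retrY i U ι) (loK (ℓ + 1) (ι.1.1 : ℕ) (zSrc i ι))
      (treeWord (s.1 - loK (ℓ + 1) (ι.1.1 : ℕ) (zSrc i ι)))) (B s.1 s.2))) (ι.1.1 : ℕ) (zSrc i ι) ι.1.2.dir with hflat
  have hflatY : flat = ((Lj : ℝ) : ℂ) • Y := by rw [hflat, hB, hS, hLj]; exact flat_sum_farRowY_eq i U ι Y
  -- `D Y − Y = Lʲ⁻¹ • (main − flat)`
  have hrow := norm_linCovIter_sub_sum_linQIter_rot_le_sum (D := d + 1) hL2 hD hα' hαQ hVu hreg17 (zSrc i ι) ι.1.2.dir B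
  have hmass := sum_norm_liftBd_farRowY_le i hU ι Y
  have hDY : QknitY i U (farRowY i (farT i U) ι Y) ι - Y = (((Lj⁻¹ : ℝ)) : ℂ) • (main - flat) := by
    rw [QknitY_apply_retract i hG1 hGU U hc hMα hreg hα' hα3 hα2 hK _ ι, smul_sub, hflatY, smul_smul, ← Complex.ofReal_mul,
      inv_mul_cancel₀ hLj0.ne', Complex.ofReal_one, one_smul]
  rw [hDY, norm_smul, Complex.norm_real, Real.norm_of_nonneg (by positivity)]
  have hL_cast : ((ℓ + 1 : ℕ) : ℝ) = (ℓ : ℝ) + 1 := by push_cast; ring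
  -- assemble the numbers
  have h1 : ‖main - flat‖ ≤ kCol (d + 1) (ℓ + 1) * α₀' * (Lj * ((Lj ^ (d + 1))⁻¹)) * (((Nn ^ d : ℕ) : ℝ) * (Lj * ‖Y‖)) := by
    refine hrow.trans ?_
    have hc0 : 0 ≤ kCol (d + 1) (ℓ + 1) * α₀' * (Lj * ((Lj ^ (d + 1))⁻¹)) := by
      have := kCol_nonneg (d + 1) (ℓ + 1); positivity
    have hm : ∑ s ∈ S, ‖B s.1 s.2‖ ≤ ((Nn ^ d : ℕ) : ℝ) * (Lj * ‖Y‖) := by rw [hB, hS, hNn, hLj]; exact hmass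
    have := mul_le_mul_of_nonneg_left hm hc0
    simpa only [hLj, Nat.cast_pow] using this
  have hNd : ((Nn ^ d : ℕ) : ℝ) = Lj ^ d := by push_cast; rw [hLjN]
  calc Lj⁻¹ * ‖main - flat‖ ≤ Lj⁻¹ * (kCol (d + 1) (ℓ + 1) * α₀' * (Lj * ((Lj ^ (d + 1))⁻¹)) * (((Nn ^ d : ℕ) : ℝ) * (Lj * ‖Y‖))) :=
        mul_le_mul_of_nonneg_left h1 (by positivity)
    _ = kCol (d + 1) (ℓ + 1) * α₀' * ‖Y‖ := by
        rw [hNd]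
        have hP : Lj ^ (d + 1) ≠ 0 := by positivity
        field_simp
        ring

end Diagonal

/-! ## §4 ★★★ `Q(U)` is onto on (3.35) -/

section Onto

open scoped Matrix Matrix.Norms.L2Operator

variable {N : ℕ} [Nonempty (Fin N)] (i : KIdx d ℓ hd hL b₀ b₁) {G : Subgroup (Matrix (Fin N) (Fin N) ℂ)ˣ}

/-- ★★★ **THE DIAGONAL MAPS ARE INJECTIVE ON (3.35)** when `K(d+1,L)·α₀′ < 1`. [cite: Balaban1985BackgroundPropagators, p.420 («ω = (QGQ*)⁻¹B»), (3.35) p.396; Balaban1985Averaging, (147) p.40] -/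
theorem QknitY_farRowY_injective_of_reg335P (hG1 : ∀ u : (Matrix (Fin N) (Fin N) ℂ)ˣ, u ∈ G → ‖(u : Matrix (Fin N) (Fin N) ℂ)‖ ≤ 1)
    (hGU : G ≤ unitaryUnits (Matrix (Fin N) (Fin N) ℂ))
    {U : CfgY (Matrix (Fin N) (Fin N) ℂ) i} {c₀ α₀ : ℝ} (hc : c₀ ≤ 10) (hMα : 0 ≤ (kGeo i).M * α₀)
    (hreg : (bg9KP (Matrix (Fin N) (Fin N) ℂ) G i).Reg335 c₀ α₀ U) {α₀' : ℝ} (hα' : 0 < α₀') (hαQ : α₀' ≤ alphaQ (d + 1) (ℓ + 1))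
    (hK : Kpl i ((kGeo i).M * α₀) * (kGeo i).L ^ 4 < α₀') (hsmall : kCol (d + 1) (ℓ + 1) * α₀' < 1) (ι : IBondY i) :
    Function.Injective fun Y : Matrix (Fin N) (Fin N) ℂ => QknitY i U (farRowY i (farT i U) ι Y) ι := by
  intro Y₁ Y₂ h
  simp only at h
  have hlin : QknitY i U (farRowY i (farT i U) ι (Y₁ - Y₂)) ι = 0 := by
    rw [map_sub, map_sub, Pi.sub_apply, h, sub_self]
  have hest := norm_QknitY_farRowY_sub_le i hG1 hGU hc hMα hreg hα' hαQ hK ι (Y₁ - Y₂)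
  rw [hlin, zero_sub, norm_neg] at hest
  have h0 : ‖Y₁ - Y₂‖ = 0 := by
    by_contra hne
    have hpos : 0 < ‖Y₁ - Y₂‖ := lt_of_le_of_ne (norm_nonneg _) (Ne.symm hne)
    have : ‖Y₁ - Y₂‖ < ‖Y₁ - Y₂‖ := by
      calc ‖Y₁ - Y₂‖ ≤ kCol (d + 1) (ℓ + 1) * α₀' * ‖Y₁ - Y₂‖ := hest
        _ < 1 * ‖Y₁ - Y₂‖ := mul_lt_mul_of_pos_right hsmall hpos
        _ = ‖Y₁ - Y₂‖ := one_mul _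
    exact lt_irrefl _ this
  exact sub_eq_zero.1 (norm_eq_zero.1 h0)

/-- ★★★ **PRINT's AVERAGING `Q(U) = QknitY i U` IS ONTO ON THE MEMBER's CLASS (3.35)** — def-Y's (L6) law `IsOntoOnQ (regQY G i c₀ α₀) (QknitY i)` unfolded — for every
background `U` of the class `(bg9KP …).Reg335 c₀ α₀`, `G ≤ U(N)` unit-bounded, `c₀ ≤ 10`, `0 ≤ Mα₀`, under the x-free numerics `0 < α₀′ ≤ α_Q(d+1,L)`, `K_pl(Mα₀)·L⁴ < α₀′`,
`K(d+1,L)·α₀′ < 1`: exact level-triangularity on the far-face rows (file `B9Eq3115KnitLetterYFarFace`) + injective diagonal (§3–§4).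
[cite: Balaban1985BackgroundPropagators, p.420 («ω = (QGQ*)⁻¹B»), (3.12)–(3.15) p.393, (3.35) p.396; Balaban1985Averaging, (139)–(147) pp.39–40, Prop. 2 p.26; Balaban1984PropagatorsI, (1.18) p.20] -/
theorem QknitY_surjective_of_reg335P (hG1 : ∀ u : (Matrix (Fin N) (Fin N) ℂ)ˣ, u ∈ G → ‖(u : Matrix (Fin N) (Fin N) ℂ)‖ ≤ 1)
    (hGU : G ≤ unitaryUnits (Matrix (Fin N) (Fin N) ℂ))
    {U : CfgY (Matrix (Fin N) (Fin N) ℂ) i} {c₀ α₀ : ℝ} (hc : c₀ ≤ 10) (hMα : 0 ≤ (kGeo i).M * α₀)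
    (hreg : (bg9KP (Matrix (Fin N) (Fin N) ℂ) G i).Reg335 c₀ α₀ U) {α₀' : ℝ} (hα' : 0 < α₀') (hαQ : α₀' ≤ alphaQ (d + 1) (ℓ + 1))
    (hK : Kpl i ((kGeo i).M * α₀) * (kGeo i).L ^ 4 < α₀') (hsmall : kCol (d + 1) (ℓ + 1) * α₀' < 1) :
    Function.Surjective (QknitY i U) :=
  QknitY_surjective_of_diag i U (farT i U) fun ι => QknitY_farRowY_injective_of_reg335P i hG1 hGU hc hMα hreg hα' hαQ hK hsmall ι

/-- ★★ hence a LINEAR RIGHT INVERSE of `Q(U)` exists on (3.35): `Q(U) ∘ S = 1`. [cite: Balaban1985BackgroundPropagators, p.420, (3.35) p.396] -/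
theorem exists_rightInverse_QknitY_of_reg335P (hG1 : ∀ u : (Matrix (Fin N) (Fin N) ℂ)ˣ, u ∈ G → ‖(u : Matrix (Fin N) (Fin N) ℂ)‖ ≤ 1)
    (hGU : G ≤ unitaryUnits (Matrix (Fin N) (Fin N) ℂ))
    {U : CfgY (Matrix (Fin N) (Fin N) ℂ) i} {c₀ α₀ : ℝ} (hc : c₀ ≤ 10) (hMα : 0 ≤ (kGeo i).M * α₀)
    (hreg : (bg9KP (Matrix (Fin N) (Fin N) ℂ) G i).Reg335 c₀ α₀ U) {α₀' : ℝ} (hα' : 0 < α₀') (hαQ : α₀' ≤ alphaQ (d + 1) (ℓ + 1))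
    (hK : Kpl i ((kGeo i).M * α₀) * (kGeo i).L ^ 4 < α₀') (hsmall : kCol (d + 1) (ℓ + 1) * α₀' < 1) :
    ∃ S : (IBondY i → Matrix (Fin N) (Fin N) ℂ) →ₗ[ℂ] (FBondY i → Matrix (Fin N) (Fin N) ℂ), QknitY i U ∘ₗ S = LinearMap.id := by
  have h := QknitY_surjective_of_reg335P i hG1 hGU hc hMα hreg hα' hαQ hK hsmall
  exact (QknitY i U).exists_rightInverse_of_surjective (LinearMap.range_eq_top.2 h)

end Onto

end Literature.MathematicalPhysics.QuantumFieldTheory.Balaban1983to89.B9Eq3115KnitLetterYOnto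

end
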